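import Summits.BirchSwinnertonDyer.Rank1Residual.X11a.PrintEisensteinHalfStatus
import HarnessLib

/-!
# Class X11a, road p1 (print route, seat p1, generation 3): ONE field- and arity-agnostic socket
# for the lower half on the surjective sub-leaf — the cyclotomic PRODUCT DISPLAY over auxiliary
# multiplicative factors; Mazur's main conjecture INTEGRALLY from it and Kato–Wuthrich

HONEST FRAMING (cell bsd-print-x11a, HOME run/shared/lean/pub/bsd-print-x11a/, seat p1 «Skinner 2016
Thm C variants BY NAME with the ramified-prime hypothesis removed via BCS 2024 base change: type +
discharge»; memo HOME/P1-ROAD.md §7). Nothing here closes the leaf: one bookkeeping structure, ONE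
typed OPEN input (a `Prop`, nothing asserted, never a fact) and theorems; every published input is an
explicit NAMED-FACT hypothesis already in the tree; nothing is booked and no label changes. «beyond-print
theorem: NO (glue + commutative algebra); a closure on this socket: YES».

WHY A THIRD SOCKET. Road p1 typed two inputs for the (ram)-free Eisenstein side of Mazur's main
conjecture at a multiplicative prime `p ≥ 5` with `ρ̄_{E,p}` onto, each bridged BY NAME to crux
stmt-BirchSwinnertonDyer-19064 on `ClassX11a ∧ 5 ≤ p ∧ Surj`:
* (S1) `X11a.EisensteinHalfAt W p` — ONE factor: `(T^e) · ch X(E/ℚ_∞) ⊆ (G)`, `ι G = ϖ L_p(E)`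
  (Skinner 2016 §3.1 read one-sidedly; `PrintEisensteinHalf.lean`);
* (S2) `X11a.BaseChangeLowerBoundAt W p` — FOUR factors `E, E^{d_K}, E^{d_F}, E^{d_K d_F}` with the
  field conditions of Burungale–Castella–Skinner Lemma 5.2.3 transcribed VERBATIM from the GOOD-ordinary
  display (5.3) (`d_K` a square and `d_F` a NON-square mod `p`, `d_K ≠ -3`, `≡ 1 (4)`, …;
  `BaseChangeRoute.lean`, cell b2b-bsdres gen 23).
The consumer of (S2) (`mazurMainConjectureAt_of_baseChangeLowerBound`) uses of those field
conditions ONLY `d ≠ 0` and `p ∤ d` (its `obtain ⟨dK, dF, hK0, -, hKsq, -, hF1, -, hFsq, hKF, hcop,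
-, -, H⟩`), while the E2 reading of BCS at `p ‖ N` (b2b HOME g23/BASE-CHANGE-TARGET.md row 1) found
that a multiplicative-prime transplant of Lemma 5.2.3 must make `p` (now a divisor of `N`) SPLIT in
the real field `F` — contradicting the transcribed clause "`d_F` a non-square mod `p`". So the one
theorem the watch-list (P1-ROAD §6 (w1)) waits for would NOT discharge (S2) as typed. This file
types the input in the shape the consumer actually needs and nothing more:

* `AuxFactorAt p κ γ` — an AUXILIARY FACTOR: a globally minimal elliptic curve `E'` multiplicative
  at `p` with `ρ̄_{E',p}` onto, one of its newforms `f'`, a Pontryagin-dual datum `D'` of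
  `Sel_{p^∞}(E'/ℚ_∞)` over `(κ, γ)`, a `ϖ' ∈ ℚ` with `ϖ' Ω_{E'} = Ω⁺_{f'}` and THE multiplicative
  Mazur–Tate–Teitelbaum function `L'` (`IsTheMultPAdicLFunctionOf`). Quadratic twists `E^d`, `p ∤ d`,
  of a curve multiplicative at `p` with onto `ρ̄` are such factors (Theorems file
  `PrintX11aLowerHalfSurjRoadP1ProductDisplay.lean`, `productDisplayAt_of_baseChangeLowerBoundAt`).
* **`ProductDisplayAt W p`** (typed OPEN input): for all cyclotomic data and all of `E`'s own data
  `(f, D, ϖ, L)` (quantified exactly as in `X2.MazurMainConjectureAt` / `EisensteinHalfAt`) there are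
  `n ≥ 0` auxiliary factors `E₁, …, E_n` and `G ∈ Λ` with
  `ι G = (ϖ ∏ ϖᵢ) · L ∏ Lᵢ` and `(T^{e + Σ eᵢ}) · ch X · ∏ ch Xᵢ ⊆ (G)`.
  `n = 0` IS (S1) (`productDisplayAt_of_eisensteinHalfAt`); (S2) gives `n = 3`
  (`Theorems.productDisplayAt_of_baseChangeLowerBoundAt`, companion Theorems file); a display over
  ONE imaginary quadratic field (two factors `E, E^{d_K}`) or over any multi-quadratic field
  unramified at `p` is an instance, WHATEVER the auxiliary splitting conditions of the eventual
  theorem are.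
* **`mazurMainConjectureAt_of_productDisplay`**: `p ≥ 5` multiplicative, `ρ̄_{E,p}` onto, the display
  ⇒ `X2.MazurMainConjectureAt W p`, INTEGRALLY, granted only Kato–Wuthrich A32 (`hKato`) — applied to
  `E` and to every auxiliary factor: `kᵢ = hᵢ cᵢ ∈ ch Xᵢ = (cᵢ)`, `ι(T^{eᵢ} kᵢ) = ϖᵢ Lᵢ`; injectivity
  of `ι` gives `G = (h ∏ hᵢ) · (T^e ∏ T^{eᵢ}) (c ∏ cᵢ)` and the display makes `h ∏ hᵢ`, hence `h`, a
  unit (`isUnit_of_mem_span_mul_self`, BCS's sentence "a proper divisibility in (5.4) would contradict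
  (5.3)" for `n + 1` factors). NO modularity hypothesis is needed here (the factors carry their data).
* Status transport: `productDisplayAt_iff_eisensteinHalfAt` / `_iff_mazurMainConjectureAt` (on
  `5 ≤ p ∧ Mult ∧ Surj`, granted A32), `bsdp_of_productDisplay`, `missingLowerBoundAt_of_productDisplay`,
  `productDisplayAt_iff_missingLowerBoundAt` (on `ClassX11a ∧ 5 ≤ p ∧ Surj`: the socket IS the lower
  half there — a SOCKET, not a new crux, referee R0-8), `CellPub.productDisplayAt` (holds from print on
  the unit cells; OPEN exactly on `X11a.Leaf ∧ Surj`). The `n = 3` bridge from (S2) and the by-name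
  bridges to item 19064 live in the companion Theorems file
  `Summits/BirchSwinnertonDyer/BirchSwinnertonDyer/Theorems/PrintX11aLowerHalfSurjRoadP1ProductDisplay.lean`.

WHAT PRINT WOULD FEED IT (P1-ROAD §6/§7 watch-list, none in print 2026-08-27): (w1) BCS Prop. 5.2.1 at
`p ‖ N` (Steinberg specialisation of Wan 2015 Thm. 3 + a zeta-element / `μ(L^{BDP}) = 0` integrality
step at `p ∣ N`) ⇒ `n = 3` with `p` split in `F`; (w2) an integral Wan 2015 Thm. 4 at the weight-`k`
Hida members + Skinner §3.1 ⇒ `n = 0`; a two-factor display over one imaginary quadratic `K` from a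
(ram)-free two-variable main conjecture at `p ‖ N` ⇒ `n = 1`.

References: [BurungaleCastellaSkinner2025] Prop. 5.2.1, Lemma 5.2.3, display (5.3) and "Proof of
Theorem 1.1.2" (arXiv:2405.00270v2 pp. 9–10); [Skinner2016PacificMC] §3.1–3.3; [Wuthrich2014] Thm. 3,
Cor. 19; [SteinWuthrich2013] Thm. 6.1; HOME/P1-ROAD.md §6–§7; b2b-bsdres-x11a g23/BASE-CHANGE-TARGET.md.
-/

set_option autoImplicit false

noncomputable section

open scoped Classical MatrixGroups ModularForm

open CongruenceSubgroup WeierstrassCurve Literature.NumberTheory.EllipticCurves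
  Literature.NumberTheory.EllipticCurves.ModularForms
  Literature.NumberTheory.EllipticCurves.Rank1Residual
  Literature.NumberTheory.EllipticCurves.Rank1Residual.Typed
  Literature.NumberTheory.EllipticCurves.Wuthrich2014
  Literature.NumberTheory.EllipticCurves.SteinWuthrich2013

namespace Summit.BirchSwinnertonDyer.Rank1Residual.X11a

/-! ### Pure algebra -/

/-- **BCS's closing sentence for any number of factors, as integral algebra in a domain**: if
`x ≠ 0` and `x ∈ (u · x)` then `u` is a unit (`x = a u x`, cancel `x`). [folklore] -/
theorem isUnit_of_mem_span_mul_self {R : Type*} [CommRing R] [IsDomain R] {x u : R}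
    (hx : x ≠ 0) (h : x ∈ Ideal.span {u * x}) : IsUnit u := by
  obtain ⟨a, ha⟩ := Ideal.mem_span_singleton'.mp h
  have key : a * u * x = 1 * x := by rw [mul_assoc, ha, one_mul]
  have h1 : a * u = 1 := mul_right_cancel₀ hx key
  exact IsUnit.of_mul_eq_one a (by rw [mul_comm]; exact h1)

/-! ### The auxiliary factors and the typed input -/

section Typed

/-- **An auxiliary factor of a cyclotomic product display at the multiplicative prime `p`** over the
cyclotomic data `(κ, γ)`: a globally minimal elliptic curve `E'/ℚ` with multiplicative reduction at
`p` and `ρ̄_{E',p}` onto (so that Kato–Wuthrich A32 applies to it for `p ≥ 5`), a newform `f'` of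
`E'`, a Pontryagin-dual datum `D'` of `Sel_{p^∞}(E'/ℚ_∞)`, a rational `ϖ'` with `ϖ' · Ω_{E'} = Ω⁺_{f'}`
and THE multiplicative Mazur–Tate–Teitelbaum function `L'` of `(E', f')`. In the base-change method the
factors are the quadratic twists `E^d`, `p ∤ d`, of `E` (BCS: `d ∈ {d_K, d_F, d_K d_F}`).
Transparent bookkeeping; nothing asserted. [cite: BurungaleCastellaSkinner2025, display (5.3) (arXiv:2405.00270v2 p. 10) (shape only)] -/
structure AuxFactorAt (p : ℕ) [Fact p.Prime] (κ : ZpExtension ℚ p)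
    (γ : Field.absoluteGaloisGroup ℚ) where
  /-- The auxiliary curve `E'` (a globally minimal model). -/
  curve : WeierstrassCurve ℚ
  /-- `E'` is an elliptic curve. -/
  [isElliptic : curve.IsElliptic]
  /-- The model is globally minimal. -/
  [isGloballyMinimal : curve.IsGloballyMinimal]
  /-- `E'` has multiplicative reduction at `p`. -/
  mult : curve.HasMultiplicativeReductionAtPrime p
  /-- `ρ̄_{E',p}` is onto `GL₂(𝔽_p)`. -/
  surj : Surj curve p
  /-- The level of the chosen newform of `E'`. -/
  level : ℕ
  /-- The level is nonzero. -/
  [neZero : NeZero level]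
  /-- A weight-two cusp form of level `Γ₀(level)`. -/
  form : CuspForm (Gamma0 level) 2
  /-- `form` is a newform of `E'`. -/
  isNewformOf : IsNewformOf curve form
  /-- A Pontryagin-dual datum of `Sel_{p^∞}(E'/ℚ_∞)` over `(κ, γ)`. -/
  dual : curve.SelmerDualData κ γ
  /-- The period ratio `ϖ'`. -/
  ϖ : ℚ
  /-- `ϖ' · Ω_{E'} = Ω⁺_{f'}`. -/
  period : (ϖ : ℝ) * curve.realPeriodRat = plusPeriod form
  /-- THE multiplicative Mazur–Tate–Teitelbaum function of `(E', f')` at `p`. -/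
  L : PowerSeries ℚ_[p]
  /-- `L` is THE multiplicative function (split / non-split according to `E'` at `p`). -/
  isL : IsTheMultPAdicLFunctionOf curve form p L


variable (W : WeierstrassCurve ℚ) [W.IsElliptic] [W.IsGloballyMinimal] (p : ℕ) [Fact p.Prime]

/-- **Typed OPEN input of road p1, field- and arity-agnostic (nothing asserted; never a fact): the
cyclotomic PRODUCT DISPLAY at the multiplicative prime `p` for `E`, Néron-normalised, with the trivial
zeros.** For the cyclotomic data `(κ, γ)`, every newform `f` of the globally minimal `W`, every
Pontryagin-dual datum `D` of `Sel_{p^∞}(E/ℚ_∞)`, every `ϖ ∈ ℚ` with `ϖ · Ω_E = Ω⁺_f` and THE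
multiplicative Mazur–Tate–Teitelbaum function `L`: there are `n ≥ 0` auxiliary factors
`E₁, …, E_n` (`AuxFactorAt`) and `G ∈ Λ = ℤ_p⟦T⟧` with `ι G = (ϖ · ∏ ϖᵢ) · (L · ∏ Lᵢ)` and
`(T^e · ∏ T^{eᵢ}) · (ch X · ∏ ch Xᵢ) ⊆ (G)` — "the product of the `ϖ`-normalised `p`-adic
`L`-functions is integral and DIVIDES the product of the characteristic ideals (with trivial-zero
factors)". `n = 0` is `EisensteinHalfAt W p`; Burungale–Castella–Skinner's display (5.3) over the
biquadratic `KF` is the case `n = 3` (factors `E^{d_K}, E^{d_F}, E^{d_K d_F}`), with NO condition on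
the auxiliary fields beyond what makes the twists factors (`p ∤ d`). STATUS: OPEN at `p ‖ N` (the
printed `n = 3` display is BCS Prop. 5.2.1 + (5.3) at GOOD ordinary `p`); holds from print on the unit
cells (`CellPub.productDisplayAt`); on `ClassX11a ∧ 5 ≤ p ∧ Surj` it is equivalent to the lower half
(`productDisplayAt_iff_missingLowerBoundAt`).
[cite: BurungaleCastellaSkinner2025, display (5.3) and "Proof of Theorem 1.1.2" (arXiv:2405.00270v2 p. 10), Prop. 5.2.1 (p. 9) (shape only; nothing asserted)]
[cite: Skinner2016PacificMC, §3.2–3.3 (shape only)] -/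
def ProductDisplayAt : Prop :=
  ∀ (κ : ZpExtension ℚ p) (γ : Field.absoluteGaloisGroup ℚ),
      κ.IsCyclotomic → κ.IsTopGenerator γ → IsCyclotomicVariable p γ →
    ∀ {N : ℕ} [NeZero N] (f : CuspForm (Gamma0 N) 2), IsNewformOf W f →
    ∀ (D : W.SelmerDualData κ γ) (ϖ : ℚ), (ϖ : ℝ) * W.realPeriodRat = plusPeriod f →
    ∀ (L : PowerSeries ℚ_[p]), IsTheMultPAdicLFunctionOf W f p L →
    ∃ (n : ℕ) (A : Fin n → AuxFactorAt p κ γ) (G : IwasawaAlgebra p),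
      iwasawaToPowerSeries p G =
          PowerSeries.C (((ϖ * ∏ i, (A i).ϖ : ℚ)) : ℚ_[p]) * (L * ∏ i, (A i).L) ∧
        Ideal.span {trivialZeroFactor W p * ∏ i, trivialZeroFactor (A i).curve p} *
          (D.charIdeal * ∏ i, (A i).dual.charIdeal) ≤ Ideal.span {G}

end Typed

section Main

variable (W : WeierstrassCurve ℚ) [W.IsElliptic] [W.IsGloballyMinimal] (p : ℕ) [Fact p.Prime]

/-- **The product display + Kato–Wuthrich ⇒ Mazur's main conjecture at `(E, p)`**, for `p ≥ 5`
multiplicative with `ρ̄_{E,p}` onto, INTEGRALLY and with NO modularity / field hypothesis: A32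
(`hKato`, PUBLISHED: Wuthrich 2014 Thm. 3 / Cor. 19 ⇐ Kato Thm. 17.4; `ρ̄_{·,p^n}` onto for all `n`
by Serre from `p ≥ 5`, for `E` AND for every auxiliary factor) gives `k = h · c ∈ ch X = (c)` with
`ι(T^e k) = ϖ L` and `kᵢ = hᵢ cᵢ ∈ ch Xᵢ = (cᵢ)` with `ι(T^{eᵢ} kᵢ) = ϖᵢ Lᵢ`; the display's `G` has
the same image under the injective `ι` as `(h ∏ hᵢ) · x`, `x = (T^e ∏ T^{eᵢ}) (c ∏ cᵢ) ≠ 0`, and the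
display puts `x ∈ (G) = ((h ∏ hᵢ) x)`, so `h ∏ hᵢ` is a unit of the domain `Λ`, hence so is `h` —
Mazur's statement with `g = c`, `w = h`. The `n`-factor twin of `mazurMainConjectureAt_of_eisensteinHalf`
(`n = 0`) and `mazurMainConjectureAt_of_baseChangeLowerBound` (`n = 3`).
[cite: BurungaleCastellaSkinner2025, "Proof of Theorem 1.1.2" with (5.3)–(5.4) (arXiv:2405.00270v2 p. 10)]
[cite: Wuthrich2014, Thm. 3 (p. 383) and Cor. 19 (pp. 398–399)] [cite: Kato2004Asterisque, Thm. 17.4] -/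
theorem mazurMainConjectureAt_of_productDisplay
    (hKato : kato_charIdeal_dvd_multiplicative_of_surjective)
    (hp : 5 ≤ p) (hmult : W.HasMultiplicativeReductionAtPrime p) (hsurj : Surj W p)
    (hPD : ProductDisplayAt W p) : X2.MazurMainConjectureAt W p := by
  intro κ γ hκ hγ hγ' N _ f hf D ϖ hϖ
  have hp2 : p ≠ 2 := by omega
  have hs₀ : ∀ n : ℕ, W.HasSurjectiveModNGaloisRep (p ^ n : ℕ) :=
    kato_charIdeal_dvd_multiplicative_of_surjective.surjective_pow_of_five_le W p hp hsurj
  obtain ⟨c₀, hc₀, hc₀0⟩ := exists_charIdeal_eq_span_singleton p D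
  -- the core: for THE function `L` of `W` and its Kato element `h₀ c₀`, `h₀` is a unit
  have core : ∀ (L : PowerSeries ℚ_[p]), IsTheMultPAdicLFunctionOf W f p L →
      ∃ w : (IwasawaAlgebra p)ˣ,
        iwasawaToPowerSeries p (trivialZeroFactor W p * c₀ * (w : IwasawaAlgebra p)) =
          PowerSeries.C ((ϖ : ℚ) : ℚ_[p]) * L := by
    intro L hL
    obtain ⟨-, k₀, hk₀, hι₀⟩ :=
      kato_trivialZeroFactor hKato W p hp2 hmult hs₀ hκ hγ hγ' hf D ϖ hϖ L hL
    rw [hc₀] at hk₀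
    obtain ⟨h₀, rfl⟩ := Ideal.mem_span_singleton'.mp hk₀
    obtain ⟨n, A, G, hιG, hG⟩ := hPD κ γ hκ hγ hγ' f hf D ϖ hϖ L hL
    -- Kato–Wuthrich for every auxiliary factor
    have hKi : ∀ i : Fin n, ∃ c h : IwasawaAlgebra p,
        (A i).dual.charIdeal = Ideal.span {c} ∧ c ≠ 0 ∧
          iwasawaToPowerSeries p (trivialZeroFactor (A i).curve p * (h * c)) =
            PowerSeries.C (((A i).ϖ : ℚ) : ℚ_[p]) * (A i).L := by
      intro i
      haveI := (A i).isElliptic; haveI := (A i).isGloballyMinimal; haveI := (A i).neZero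
      obtain ⟨c, hc, hc0⟩ := exists_charIdeal_eq_span_singleton p (A i).dual
      obtain ⟨-, k, hk, hι⟩ := kato_trivialZeroFactor hKato (A i).curve p hp2 (A i).mult
        (kato_charIdeal_dvd_multiplicative_of_surjective.surjective_pow_of_five_le (A i).curve p hp
          (A i).surj)
        hκ hγ hγ' (A i).isNewformOf (A i).dual (A i).ϖ (A i).period (A i).L (A i).isL
      rw [hc] at hk
      obtain ⟨h, rfl⟩ := Ideal.mem_span_singleton'.mp hk
      exact ⟨c, h, hc, hc0, hι⟩
    choose c h hc hc0 hι using hKi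
    set t₀ := trivialZeroFactor W p with ht₀
    -- the display's `G` is `(h₀ ∏ hᵢ) · x`, `x = (t₀ ∏ tᵢ) (c₀ ∏ cᵢ)`
    have hGeq : G = (h₀ * ∏ i, h i) *
        ((t₀ * ∏ i, trivialZeroFactor (A i).curve p) * (c₀ * ∏ i, c i)) := by
      apply iwasawaToPowerSeries_injective p
      have hre : (h₀ * ∏ i, h i) *
          ((t₀ * ∏ i, trivialZeroFactor (A i).curve p) * (c₀ * ∏ i, c i)) =
          (t₀ * (h₀ * c₀)) * ∏ i, (trivialZeroFactor (A i).curve p * (h i * c i)) := by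
        rw [Finset.prod_mul_distrib, Finset.prod_mul_distrib]
        ring
      rw [hre, map_mul, map_prod, hι₀, hιG]
      simp only [hι, Finset.prod_mul_distrib, ← map_prod]
      push_cast
      rw [map_mul]
      ring
    have hx : (t₀ * ∏ i, trivialZeroFactor (A i).curve p) * (c₀ * ∏ i, c i) ≠ 0 :=
      mul_ne_zero
        (mul_ne_zero (trivialZeroFactor_ne_zero W p)
          (Finset.prod_ne_zero_iff.mpr fun i _ => trivialZeroFactor_ne_zero (A i).curve p))
        (mul_ne_zero hc₀0 (Finset.prod_ne_zero_iff.mpr fun i _ => hc0 i))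
    have hmem : (t₀ * ∏ i, trivialZeroFactor (A i).curve p) * (c₀ * ∏ i, c i) ∈
        Ideal.span {(h₀ * ∏ i, h i) *
          ((t₀ * ∏ i, trivialZeroFactor (A i).curve p) * (c₀ * ∏ i, c i))} := by
      rw [← hGeq]
      refine hG (Ideal.mul_mem_mul (Ideal.mem_span_singleton_self _) ?_)
      refine Ideal.mul_mem_mul ?_ (Ideal.prod_mem_prod fun i _ => ?_)
      · rw [hc₀]; exact Ideal.mem_span_singleton_self _
      · rw [hc i]; exact Ideal.mem_span_singleton_self _
    have hu : IsUnit (h₀ * ∏ i, h i) := isUnit_of_mem_span_mul_self hx hmem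
    have hu₀ : IsUnit h₀ := isUnit_of_mul_isUnit_left hu
    refine ⟨hu₀.unit, ?_⟩
    rw [IsUnit.unit_spec, ← hι₀]
    congr 1
    ring
  obtain ⟨hX, -⟩ := hKato W p hp2 hmult hs₀ hκ hγ hγ' hf D ϖ hϖ
  refine ⟨hX, c₀, hc₀, fun hsplit L hL => ?_, fun hns L hL => ?_⟩
  · obtain ⟨w, hw⟩ := core L ⟨fun _ => hL, fun h => (h hsplit).elim⟩
    refine ⟨w, ?_⟩
    rw [← hw, trivialZeroFactor_of_split W p hsplit]
  · obtain ⟨w, hw⟩ := core L ⟨fun h => (hns h).elim, fun _ => hL⟩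
    refine ⟨w, ?_⟩
    rw [← hw, trivialZeroFactor_of_not_split W p hns, one_mul]

omit [W.IsElliptic] [W.IsGloballyMinimal] in
/-- **(S1) is the case `n = 0`**: the Eisenstein half gives the product display with NO auxiliary
factor (empty products). Pure logic. [folklore] -/
theorem productDisplayAt_of_eisensteinHalfAt (hE : EisensteinHalfAt W p) : ProductDisplayAt W p := by
  intro κ γ hκ hγ hγ' N _ f hf D ϖ hϖ L hL
  obtain ⟨G, hιG, hG⟩ := hE κ γ hκ hγ hγ' f hf D ϖ hϖ L hL
  refine ⟨0, fun i => Fin.elim0 i, G, ?_, ?_⟩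
  · simpa using hιG
  · simpa using hG

/-- **Conversely, Mazur's main conjecture at `(E, p)` gives the product display** (with `n = 0`,
through `eisensteinHalfAt_of_mazurMainConjectureAt`; pure algebra, no hypothesis on `p` or the image).
[folklore] -/
theorem productDisplayAt_of_mazurMainConjectureAt (hMC : X2.MazurMainConjectureAt W p) :
    ProductDisplayAt W p :=
  productDisplayAt_of_eisensteinHalfAt W p (eisensteinHalfAt_of_mazurMainConjectureAt W p hMC)

/-- **The product display gives back the one-factor Eisenstein half** at `p ≥ 5` multiplicative with
`ρ̄_{E,p}` onto, granted A32 (through Mazur's main conjecture). [cite: Wuthrich2014, Thm. 3 and Cor. 19] -/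
theorem eisensteinHalfAt_of_productDisplay
    (hKato : kato_charIdeal_dvd_multiplicative_of_surjective)
    (hp : 5 ≤ p) (hmult : W.HasMultiplicativeReductionAtPrime p) (hsurj : Surj W p)
    (hPD : ProductDisplayAt W p) : EisensteinHalfAt W p :=
  eisensteinHalfAt_of_mazurMainConjectureAt W p
    (mazurMainConjectureAt_of_productDisplay W p hKato hp hmult hsurj hPD)

/-- **On {`p ≥ 5`, `p ‖ N`, `ρ̄_{E,p}` onto} the product display IS Mazur's main conjecture at the
pair** (granted the PUBLISHED A32): the socket is neither weaker nor stronger than the cell's typed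
input of record there; what it buys is CONSUMABILITY (any number of auxiliary factors, no field
conditions). [cite: Wuthrich2014, Thm. 3 and Cor. 19] [cite: BurungaleCastellaSkinner2025, display (5.3) (shape)] -/
theorem productDisplayAt_iff_mazurMainConjectureAt
    (hKato : kato_charIdeal_dvd_multiplicative_of_surjective)
    (hp : 5 ≤ p) (hmult : W.HasMultiplicativeReductionAtPrime p) (hsurj : Surj W p) :
    ProductDisplayAt W p ↔ X2.MazurMainConjectureAt W p :=
  ⟨mazurMainConjectureAt_of_productDisplay W p hKato hp hmult hsurj,
    productDisplayAt_of_mazurMainConjectureAt W p⟩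

/-- **The three sockets of road p1 agree on {`p ≥ 5`, `p ‖ N`, `ρ̄_{E,p}` onto}**, granted A32:
`ProductDisplayAt W p ↔ EisensteinHalfAt W p`. [cite: Wuthrich2014, Thm. 3 and Cor. 19] -/
theorem productDisplayAt_iff_eisensteinHalfAt
    (hKato : kato_charIdeal_dvd_multiplicative_of_surjective)
    (hp : 5 ≤ p) (hmult : W.HasMultiplicativeReductionAtPrime p) (hsurj : Surj W p) :
    ProductDisplayAt W p ↔ EisensteinHalfAt W p :=
  ⟨eisensteinHalfAt_of_productDisplay W p hKato hp hmult hsurj,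
    productDisplayAt_of_eisensteinHalfAt W p⟩

/-- **`BSD(E,p)` on class X11a at `p ≥ 5` with surjective `ρ̄_{E,p}` from the product display** —
the typed OPEN input `ProductDisplayAt W p` plus the PUBLISHED named facts Kato–Wuthrich A32
(`hKato`), Stein–Wuthrich 2013 Thm. 6.1 split / non-split (`hJs`, `hJn`), Greenberg–Stevens (`hGS`),
Gross–Zagier–Kolyvagin (`hGZK`) and modularity counted once (`hNf : exists_isNewformOf`); glue
`eisensteinHalfAt_of_productDisplay` + `bsdp_of_eisensteinHalf`. Nothing booked; no label change.
[cite: SteinWuthrich2013, Thm. 6.1 (p. 20)] [cite: Wuthrich2014, Thm. 3 and Cor. 19]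
[cite: BurungaleCastellaSkinner2025, "Proof of Theorem 1.1.2" (arXiv:2405.00270v2 p. 10) (shape)] -/
theorem bsdp_of_productDisplay (hNf : exists_isNewformOf)
    (hKato : kato_charIdeal_dvd_multiplicative_of_surjective)
    (hJs : thm61_splitMultiplicative) (hJn : thm61_nonsplitMultiplicative)
    (hGZK : rank_eq_analyticRank_of_analyticRank_le_one)
    (hGS : greenberg_stevens (W := W) (p := p))
    (hX : ClassX11a W p) (hp : 5 ≤ p) (hsurj : Surj W p) (hPD : ProductDisplayAt W p) :
    BSDp W p :=
  bsdp_of_eisensteinHalf W p hNf hKato hJs hJn hGZK hGS hX hp hsurj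
    (eisensteinHalfAt_of_productDisplay W p hKato hp hX.mult hsurj hPD)

/-- **The product display reaches the cell's residual crux of record BY NAME on the surjective
sub-leaf**: item stmt-BirchSwinnertonDyer-19064 `X11aLowerHalf` asks for
`Typed.MissingLowerBoundAt W p` (`ord_p #Ш_an ≤ ord_p #Ш`) at every X11a pair; at an X11a pair with
`p ≥ 5` and `ρ̄_{E,p}` onto, the product display delivers it (through the Eisenstein half).
[cite: Miller2011LMS, Def. 1.1] [cite: SteinWuthrich2013, Thm. 6.1 (p. 20)] -/
theorem missingLowerBoundAt_of_productDisplay (hNf : exists_isNewformOf)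
    (hKato : kato_charIdeal_dvd_multiplicative_of_surjective)
    (hJs : thm61_splitMultiplicative) (hJn : thm61_nonsplitMultiplicative)
    (hGZK : rank_eq_analyticRank_of_analyticRank_le_one)
    (hGS : greenberg_stevens (W := W) (p := p))
    (hX : ClassX11a W p) (hp : 5 ≤ p) (hsurj : Surj W p) (hPD : ProductDisplayAt W p) :
    MissingLowerBoundAt W p :=
  missingLowerBoundAt_of_eisensteinHalf W p hNf hKato hJs hJn hGZK hGS hX hp hsurj
    (eisensteinHalfAt_of_productDisplay W p hKato hp hX.mult hsurj hPD)

/-- **On `ClassX11a ∧ 5 ≤ p ∧ Surj` the product display IS the lower half** (the body of crux 19064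
at the pair), granted the PUBLISHED facts (incl. Stein–Wuthrich with THE heights `hHs`, `hHn`, as
in `eisensteinHalfAt_iff_missingLowerBoundAt`): a SOCKET, not a new crux (referee R0-8).
[cite: Wuthrich2014, Thm. 3 and Cor. 19] [cite: SteinWuthrich2013, Thm. 6.1 (p. 20)] [cite: Miller2011LMS, Def. 1.1] -/
theorem productDisplayAt_iff_missingLowerBoundAt (hNf : exists_isNewformOf)
    (hKato : kato_charIdeal_dvd_multiplicative_of_surjective)
    (hJs : thm61_splitMultiplicative) (hJn : thm61_nonsplitMultiplicative)
    (hHs : exists_isSplitMultCanonical) (hHn : exists_isMultCanonical)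
    (hGZK : rank_eq_analyticRank_of_analyticRank_le_one)
    (hGS : greenberg_stevens (W := W) (p := p))
    (hX : ClassX11a W p) (hp : 5 ≤ p) (hsurj : Surj W p) :
    ProductDisplayAt W p ↔ MissingLowerBoundAt W p :=
  (productDisplayAt_iff_eisensteinHalfAt W p hKato hp hX.mult hsurj).trans
    (eisensteinHalfAt_iff_missingLowerBoundAt W p hNf hKato hJs hJn hHs hHn hGZK hGS hX hp hsurj)

/-- **On the PUBLISHED sub-cell `CellPub` (`p ≥ 5`, `ρ̄` onto, `p ∤ #Ш_an`) the product display holds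
from print** (Wuthrich 2014 Prop. 21 via `CellPub.eisensteinHalfAt`, `n = 0`): the socket is OPEN
exactly on `X11a.Leaf ∧ Surj` (`p ∣ #Ш_an`). [cite: Wuthrich2014, Prop. 21 (p. 400)]
[cite: SteinWuthrich2013, Thm. 6.1 (p. 20)] -/
theorem CellPub.productDisplayAt (hWu : sha_dvd_analyticSha)
    (hKato : kato_charIdeal_dvd_multiplicative_of_surjective)
    (hJs : thm61_splitMultiplicative) (hJn : thm61_nonsplitMultiplicative)
    (hHs : exists_isSplitMultCanonical) (hHn : exists_isMultCanonical)
    (hGZK : rank_eq_analyticRank_of_analyticRank_le_one) (hmod : hasEntireLFunction_rat)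
    (hGS : greenberg_stevens (W := W) (p := p)) (h : CellPub W p) : ProductDisplayAt W p :=
  productDisplayAt_of_eisensteinHalfAt W p
    (CellPub.eisensteinHalfAt W p hWu hKato hJs hJn hHs hHn hGZK hmod hGS h)

end Main

end Summit.BirchSwinnertonDyer.Rank1Residual.X11a

end
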